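import Literature.NumberTheory.Automorphic.QuadraticLocalNormResidueBridge
import Literature.NumberTheory.Automorphic.UnitaryGroupFrameSubform
import Literature.NumberTheory.QuadraticForms.HilbertReciprocityFiniteness
import Literature.NumberTheory.Automorphic.AdelicUnitaryGroup
import HarnessLib

/-!
# The FORM SIGN `ε_v(H)` of a rank-3 hermitian form at a finite place: the norm class of `−det H` in `F_vˣ ∕ N(E_wˣ)`
# (Rogawski (1990) §14.6 pp. 242–244: the discrepancy `c_v = ±1`, «`+1` for almost all `v`», between the explicit factor `Δ‴_v` and the transported canonical `Δ_v ∘ ψ_v`)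

Topic `NumberTheory/Automorphic`; namespace `Literature.NumberTheory.Automorphic.UnitaryGroup` (home of ★ `LocalRing`, ★ `conjLocal`, ★ `formCongr`, ★
`ite_normTest_algebraMap_eq_hilbertSymbol`).  ONE definition with body (`formSignAt`) + theorems; no instance, no notation, no named fact, no `sorry`.
Cell `pub/hodgecm-mathlib`, crux H413 = `stmt-HodgeConjecture-24833`, line LH7 (closer row #181 `stub_PKtuple`), LEAD F0P3a-plan (g13) RULING K2′ (T12-11,
2026-09-02): «a print pairing VALUE quoted in a kit law stated at the tree՚s `Δ‴_v` is multiplied by the form sign — to be exposed as ONE closed ★ def `formSignAt`»;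
pen LH7-p01 (g0) (flag F10, memo `F0/P3c/LH7/LH7-p01/g0/MEMO-KG1-signed-pairing.v1.md`).

THE MATHEMATICS.  For `c`-hermitian `H ∈ M₃(E)` (`E ∕ F` quadratic, `c` the conjugation) and a finite place `v` of `F`, every local similarity `ᵗ(c⊗1)(T) · H_v · T = a · Φ₃`
(`T ∈ GL₃(E_v)`, `a ∈ E_vˣ` with `(c⊗1) a = a`; ★ `exists_formCongr_map_eq_smul_antidiag_of_smul_eq`) has `N(det T) · det H = a³ · det Φ₃ = −a³`, so `−det H = a · N(a ∕ det T)`: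
the class of the scalar `a` modulo unit norms is the class of `−det H`, INDEPENDENT of the similarity.  `formSignAt E c H v ∈ {±1}` is the three-way test of ★
`Rogawski1990.finKappaAt` on `−det H` («`+1` at a split `v`; else `+1` iff `−det H = z · (c⊗1) z` for a unit `z` of `E ⊗_F F_v`; else `−1`»), i.e. the Hilbert symbol
`(−det H, d)_v` for `E = F(√d)` (★ `ite_normTest_algebraMap_eq_hilbertSymbol`), `+1` for all but finitely many `v` (★ `finite_setOf_hilbertSymbol_eq_neg_one`, O'Meara 71:18).
It is the sign by which the explicit transfer factor `Δ‴_v` of ★ `FinExplicitTransferFactor` differs from the canonical factor transported along the similarity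
(`κ_v(γ_H, ψ_v⁻¹ γ) = η_v(a) · κ_v^{Φ₃}(γ_H, γ)`), hence the sign `(if ∃ z, IsUnit z ∧ a = z · (c⊗1) z then 1 else −1)` carried by the signed character identities ★
`Rogawski1990.CMCharIdentityClausesTestSigned` — `ite_isUnitNorm_eq_formSignAt_of_formCongr_eq_smul` below identifies the two.
[cite: Rogawski1990, §14.6 pp. 242–244; §4.9 p. 55; §3.5 Prop. 3.5.2 (c) p. 29] [cite: Jacobowitz1962, §3 Thm. 3.1] [cite: Omeara1963, §71 Thm. 71:18]

CONTENTS.  §1 `formSignAt` (+ unfoldings, `= 1 ∨ = −1`, split ⇒ `1`).  §2 the similarity bridge `ite_isUnitNorm_eq_formSignAt_of_formCongr_eq_smul` (pure algebra over the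
commutative ring `E_v`: both directions of `(∃ u unit, a = u·c̄u) ↔ (∃ u unit, −det H = u·c̄u)`).  §3 `formSignAt_eq_hilbertSymbol` and `finite_setOf_formSignAt_eq_neg_one`
(given `δ`, `d` with `c δ = −δ ≠ 0`, `δ² = d`, and `x ∈ Fˣ` with `x = −det H`).
HONEST LABEL: HC_CM is proved only modulo the printed citations (2 named inputs hLiu418 ∕ h413) until rung 0 closes; this file is local algebra and pays nothing by itself.

## References
* [Rogawski1990] J. D. Rogawski, *Automorphic Representations of Unitary Groups in Three Variables*, Ann. of Math. Stud. 123 (1990), §14.6 pp. 242–244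
  (`Δ′_v = c_v Δ″_v`, `c = ∏ c_v = ±1`), §4.9 p. 55, §3.5 Prop. 3.5.2 (c) p. 29.
* [Jacobowitz1962] R. Jacobowitz, *Hermitian forms over local fields*, Amer. J. Math. 84 (1962), §3 Thm. 3.1.
* [Omeara1963] O. T. O'Meara, *Introduction to Quadratic Forms* (1963), §63B, §71 Thm. 71:18.
-/

set_option autoImplicit false

noncomputable section

open Matrix NumberField IsDedekindDomain
open Literature.NumberTheory.QuadraticForms

namespace Literature.NumberTheory.Automorphic.UnitaryGroup

variable {F : Type} (E : Type) [Field F] [NumberField F] [Field E] [NumberField E] [Algebra F E] (σ : E ≃ₐ[F] E)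

/-! ## §1 The form sign -/

open scoped Classical in
/-- **`formSignAt E σ H v = ε_v(H) ∈ {±1}`** — the norm class of `−det H` at the finite place `v`, by the three-way test of ★ `Rogawski1990.finKappaAt`: `+1` if `v` splits in `E`;
otherwise `+1` iff `−det H ⊗ 1 = z · (σ⊗1) z` for a unit `z` of `E ⊗_F F_v`; otherwise `−1`.  For a rank-3 hermitian `H` this is the class of the scalar `a` of ANY local
similarity `H_v ≃ a · Φ₃` (§2), i.e. print՚s local discrepancy sign `c_v` between the explicit and the transported canonical transfer factor.
[cite: Rogawski1990, §14.6 p. 242; §3.5 Prop. 3.5.2 (c) p. 29] [cite: Jacobowitz1962, §3 Thm. 3.1] -/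
def formSignAt (H : Matrix (Fin 3) (Fin 3) E) (v : HeightOneSpectrum (𝓞 F)) : ℤ :=
  if ¬ Subsingleton (PlacesOver E v) then 1
  else if ∃ z : LocalRing E v, IsUnit z ∧ algebraMap E (LocalRing E v) (-H.det) = z * conjLocal E σ v z then 1
  else -1

variable (H : Matrix (Fin 3) (Fin 3) E) (v : HeightOneSpectrum (𝓞 F))

open scoped Classical in
/-- Unfolding of `formSignAt`. [cite: Rogawski1990, §14.6 p. 242] -/
theorem formSignAt_def :
    formSignAt E σ H v =
      if ¬ Subsingleton (PlacesOver E v) then 1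
      else if ∃ z : LocalRing E v, IsUnit z ∧ algebraMap E (LocalRing E v) (-H.det) = z * conjLocal E σ v z then 1
      else -1 :=
  rfl

/-- `formSignAt ∈ {1, −1}`. [cite: Rogawski1990, §14.6 p. 242] -/
theorem formSignAt_eq_one_or_eq_neg_one : formSignAt E σ H v = 1 ∨ formSignAt E σ H v = -1 := by
  classical
  unfold formSignAt
  split_ifs <;> simp

/-- `formSignAt² = 1`. [cite: Rogawski1990, §14.6 p. 242] -/
theorem formSignAt_mul_self : formSignAt E σ H v * formSignAt E σ H v = 1 := by
  rcases formSignAt_eq_one_or_eq_neg_one E σ H v with h | h <;> rw [h] <;> norm_num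

/-- **At a SPLIT place the form sign is `+1`** (two places above `v`; every unit of `F_v` is a norm from `E ⊗_F F_v ≅ F_v × F_v`). [cite: Rogawski1990, §14.6 p. 242] -/
theorem formSignAt_of_not_subsingleton (hv : ¬ Subsingleton (PlacesOver E v)) : formSignAt E σ H v = 1 := by
  classical
  unfold formSignAt
  rw [if_pos hv]

open scoped Classical in
/-- At a NON-SPLIT place the form sign is the unit-norm test on `−det H`. [cite: Rogawski1990, §14.6 p. 242; §3.5 Prop. 3.5.2 (c) p. 29] -/
theorem formSignAt_of_subsingleton (hv : Subsingleton (PlacesOver E v)) :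
    formSignAt E σ H v =
      if ∃ z : LocalRing E v, IsUnit z ∧ algebraMap E (LocalRing E v) (-H.det) = z * conjLocal E σ v z then 1 else -1 := by
  unfold formSignAt
  rw [if_neg (not_not.2 hv)]

/-! ## §2 The similarity bridge: the class of the scalar `a` of `H_v ≃ a · Φ₃` is the class of `−det H` -/

omit [NumberField F] [NumberField E] in
/-- `det Φ₃ = −1` for the antidiagonal unit form in rank `3` (the permutation `(1 3)` is odd), after any ring map. [cite: Rogawski1990, §14.2 (14.2.1) p. 232] -/
theorem det_antidiagOne_three_map {S : Type*} [CommRing S] (f : E →+* S) :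
    ((Matrix.of fun i j : Fin 3 => if i.val + j.val + 1 = 3 then (1 : E) else 0).map f).det = -1 := by
  rw [Matrix.det_fin_three]
  simp [Matrix.map_apply, Matrix.of_apply]

/-- **THE SCALAR OF A LOCAL SIMILARITY HAS THE NORM CLASS OF `−det H`** (pure algebra over the commutative ring `E_v = E ⊗_F F_v`): if `ᵗ(σ⊗1)(T) · H_v · T = a · Φ₃` with
`T ∈ GL₃(E_v)`, `a` a `(σ⊗1)`-fixed unit, then `a` is a unit norm iff `−det H ⊗ 1` is: from ★ `det_formCongr`, `(σ⊗1)(det T) · det H_v · det T = a³ · det Φ₃ = −a³`, whence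
`−det H_v = a · N(a ∕ det T)` (`a² = N(a)` as `a` is fixed) and `a = N(a · z ∕ (a ∕ det T))`-type rearrangements.  Consequently the sign
`(if ∃ z, IsUnit z ∧ a = z · (σ⊗1) z then 1 else −1)` of ★ `Rogawski1990.CMCharIdentityClausesTestSigned` at a non-split `v` IS `formSignAt E σ H v`.
[cite: Jacobowitz1962, §3 Thm. 3.1] [cite: Rogawski1990, §3.5 Prop. 3.5.2 (c) p. 29; §14.6 p. 242] -/
theorem exists_isUnit_eq_mul_conjLocal_iff_of_formCongr_eq_smul {T : GL (Fin 3) (LocalRing E v)} {a : LocalRing E v}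
    (ha : IsUnit a) (hσa : conjLocal E σ v a = a)
    (h : formCongr (conjLocal E σ v) T (H.map (algebraMap E (LocalRing E v))) =
      a • (Matrix.of fun i j : Fin 3 => if i.val + j.val + 1 = 3 then (1 : E) else 0).map (algebraMap E (LocalRing E v))) :
    (∃ z : LocalRing E v, IsUnit z ∧ a = z * conjLocal E σ v z) ↔
      ∃ z : LocalRing E v, IsUnit z ∧ algebraMap E (LocalRing E v) (-H.det) = z * conjLocal E σ v z := by
  -- the determinant identity `σ(det T) · det H_v · det T = −a³`
  set c := conjLocal E σ v with hc
  set d : LocalRing E v := ((T : Matrix (Fin 3) (Fin 3) (LocalRing E v))).det with hd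
  have hdU : IsUnit d := Matrix.isUnits_det_units T
  have hdet : c d * algebraMap E (LocalRing E v) H.det * d = -(a ^ 3) := by
    have h1 := congrArg Matrix.det h
    rw [det_formCongr, Matrix.det_smul, det_antidiagOne_three_map, Fintype.card_fin, ← RingHom.mapMatrix_apply, ← RingHom.map_det] at h1
    rw [h1]; ring
  have hx : algebraMap E (LocalRing E v) (-H.det) = -algebraMap E (LocalRing E v) H.det := map_neg _ _
  obtain ⟨dinv, hdinv⟩ := hdU.exists_right_inv
  obtain ⟨ainv, hainv⟩ := ha.exists_right_inv
  constructor
  · -- `a = u·c u` ⇒ `−det H_v = N(u³ · dinv)` (times the unit-norm bookkeeping)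
    rintro ⟨u, hu, hau⟩
    refine ⟨u ^ 3 * dinv, (hu.pow 3).mul (isUnit_iff_exists_inv.2 ⟨d, by rw [mul_comm]; exact hdinv⟩), ?_⟩
    -- `−det H_v · (c d · d) = a³` and `c dinv · dinv · (c d · d) = 1`
    have hN : c dinv * dinv * (c d * d) = 1 := by
      have : c (d * dinv) = 1 := by rw [hdinv, map_one]
      rw [map_mul] at this
      calc c dinv * dinv * (c d * d) = (c d * c dinv) * (d * dinv) := by ring
        _ = 1 := by rw [this, hdinv, one_mul]
    have key : algebraMap E (LocalRing E v) (-H.det) * (c d * d) = a ^ 3 := by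
      rw [hx]; linear_combination (-1 : LocalRing E v) * hdet
    calc algebraMap E (LocalRing E v) (-H.det)
        = algebraMap E (LocalRing E v) (-H.det) * (c d * d) * (c dinv * dinv) := by
            rw [mul_assoc, mul_comm (c d * d), hN, mul_one]
      _ = a ^ 3 * (c dinv * dinv) := by rw [key]
      _ = (u ^ 3 * dinv) * c (u ^ 3 * dinv) := by rw [hau, map_mul, map_pow]; ring
  · -- `−det H_v = y·c y` ⇒ `a³ = N(y·d)`, and `a = a³ ∕ a² = a³ ∕ N(a)` since `c a = a`
    rintro ⟨y, hy, hyN⟩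
    refine ⟨y * d * ainv, (hy.mul hdU).mul (isUnit_iff_exists_inv.2 ⟨a, by rw [mul_comm]; exact hainv⟩), ?_⟩
    have hcainv : c ainv * a = 1 := by
      have : c (a * ainv) = 1 := by rw [hainv, map_one]
      rwa [map_mul, hσa, mul_comm] at this
    have key : a ^ 3 = (y * c y) * (c d * d) := by
      rw [← hyN, hx]; linear_combination hdet
    calc a = a ^ 3 * (ainv * (c ainv * a) * ainv) := by
            linear_combination (-(a ^ 3 * ainv * ainv)) * hcainv + (-(a * (a * ainv + 1))) * hainv
      _ = (y * c y) * (c d * d) * (ainv * (c ainv * a) * ainv) := by rw [key]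
      _ = (y * d * ainv) * c (y * d * ainv) := by
            rw [map_mul, map_mul]
            linear_combination (y * c y * (c d * d) * ainv * c ainv) * hainv

open scoped Classical in
/-- **THE SIGN OF THE SIGNED CHARACTER IDENTITIES IS THE FORM SIGN**: at a non-split `v`, for any local similarity `H_v ≃ a · Φ₃` with `a` a `(σ⊗1)`-fixed unit,
`(if ∃ z, IsUnit z ∧ a = z · (σ⊗1) z then 1 else −1) = formSignAt E σ H v`. [cite: Rogawski1990, §14.6 p. 242; §3.5 Prop. 3.5.2 (c) p. 29] [cite: Jacobowitz1962, §3 Thm. 3.1] -/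
theorem ite_isUnitNorm_eq_formSignAt_of_formCongr_eq_smul (hv : Subsingleton (PlacesOver E v)) {T : GL (Fin 3) (LocalRing E v)} {a : LocalRing E v}
    (ha : IsUnit a) (hσa : conjLocal E σ v a = a)
    (h : formCongr (conjLocal E σ v) T (H.map (algebraMap E (LocalRing E v))) =
      a • (Matrix.of fun i j : Fin 3 => if i.val + j.val + 1 = 3 then (1 : E) else 0).map (algebraMap E (LocalRing E v))) :
    (if ∃ z : LocalRing E v, IsUnit z ∧ a = z * conjLocal E σ v z then (1 : ℤ) else -1) = formSignAt E σ H v := by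
  rw [formSignAt_of_subsingleton E σ H v hv]
  by_cases hex : ∃ z : LocalRing E v, IsUnit z ∧ a = z * conjLocal E σ v z
  · rw [if_pos hex, if_pos ((exists_isUnit_eq_mul_conjLocal_iff_of_formCongr_eq_smul E σ H v ha hσa h).1 hex)]
  · rw [if_neg hex, if_neg (fun h' => hex ((exists_isUnit_eq_mul_conjLocal_iff_of_formCongr_eq_smul E σ H v ha hσa h).2 h'))]

open scoped Classical in
/-- The same bridge read from the form sign (the name the desk՚s price sheet uses): at a non-split `v`, for any local similarity `H_v ≃ a · Φ₃` with `a` a `(σ⊗1)`-fixed unit,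
`formSignAt E σ H v = (if ∃ z, IsUnit z ∧ a = z · (σ⊗1) z then 1 else −1)` — the clause sign of ★ `Rogawski1990.CMCharIdentityClausesTestSigned`.
[cite: Rogawski1990, §14.6 p. 242; §3.5 Prop. 3.5.2 (c) p. 29] [cite: Jacobowitz1962, §3 Thm. 3.1] -/
theorem formSignAt_eq_ite_of_formCongr (hv : Subsingleton (PlacesOver E v)) {T : GL (Fin 3) (LocalRing E v)} {a : LocalRing E v}
    (ha : IsUnit a) (hσa : conjLocal E σ v a = a)
    (h : formCongr (conjLocal E σ v) T (H.map (algebraMap E (LocalRing E v))) =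
      a • (Matrix.of fun i j : Fin 3 => if i.val + j.val + 1 = 3 then (1 : E) else 0).map (algebraMap E (LocalRing E v))) :
    formSignAt E σ H v = (if ∃ z : LocalRing E v, IsUnit z ∧ a = z * conjLocal E σ v z then (1 : ℤ) else -1) :=
  (ite_isUnitNorm_eq_formSignAt_of_formCongr_eq_smul E σ H v hv ha hσa h).symm

open scoped Classical in
/-- **Complex form of the bridge** (how the signed identities consume it: the clause sign is cast to `ℂ`): `((if … then 1 else −1 : ℤ) : ℂ) = (formSignAt E σ H v : ℂ)`.
[cite: Rogawski1990, §14.6 p. 242] -/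
theorem intCast_ite_isUnitNorm_eq_formSignAt_of_formCongr_eq_smul (hv : Subsingleton (PlacesOver E v)) {T : GL (Fin 3) (LocalRing E v)}
    {a : LocalRing E v} (ha : IsUnit a) (hσa : conjLocal E σ v a = a)
    (h : formCongr (conjLocal E σ v) T (H.map (algebraMap E (LocalRing E v))) =
      a • (Matrix.of fun i j : Fin 3 => if i.val + j.val + 1 = 3 then (1 : E) else 0).map (algebraMap E (LocalRing E v))) :
    (if ∃ z : LocalRing E v, IsUnit z ∧ a = z * conjLocal E σ v z then (1 : ℂ) else -1) = ((formSignAt E σ H v : ℤ) : ℂ) := by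
  rw [← ite_isUnitNorm_eq_formSignAt_of_formCongr_eq_smul E σ H v hv ha hσa h]
  split_ifs <;> simp

/-! ## §3 The form sign as a Hilbert symbol; finiteness of the places of sign `−1` -/

variable {δ : E} (hσδ : σ δ = -δ) (hδ : δ ≠ 0) {d : F} (hd : δ * δ = algebraMap F E d)

include hσδ hδ hd in
/-- **`formSignAt E σ H v = (x, d)_v`** for `x ∈ Fˣ` with `x ⊗ 1 = −det H` (for hermitian `H`, `−det H ∈ F`) and `E = F(√d)` (`σ ≠ 1`): ★ `ite_normTest_algebraMap_eq_hilbertSymbol`.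
[cite: Omeara1963, §63B; §71 Thm. 71:18] [cite: Rogawski1990, §14.6 p. 242] -/
theorem formSignAt_eq_hilbertSymbol [Algebra.IsQuadraticExtension F E] (hσ : σ ≠ 1) {x : F} (hx0 : x ≠ 0) (hx : algebraMap F E x = -H.det) :
    formSignAt E σ H v = hilbertSymbol (v.adicCompletion F) (x : v.adicCompletion F) (d : v.adicCompletion F) := by
  classical
  rw [formSignAt_def, ← hx]
  exact ite_normTest_algebraMap_eq_hilbertSymbol E σ hσδ hδ hd hσ v hx0

include hσδ hδ hd in
/-- **THE PLACES OF FORM SIGN `−1` ARE FINITE** («`c_v = 1` for almost all `v`»): `{v | formSignAt E σ H v = −1}` is finite, by Hilbert-symbol finiteness (O'Meara 71:18, ★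
`finite_setOf_hilbertSymbol_eq_neg_one`) for `(x, d)` with `x ⊗ 1 = −det H ≠ 0`, `d ≠ 0`. [cite: Omeara1963, §71 Thm. 71:18] [cite: Rogawski1990, §14.6 p. 242] -/
theorem finite_setOf_formSignAt_eq_neg_one [Algebra.IsQuadraticExtension F E] (hσ : σ ≠ 1) {x : F} (hx0 : x ≠ 0) (hx : algebraMap F E x = -H.det) (hd0 : d ≠ 0) :
    {v : HeightOneSpectrum (𝓞 F) | formSignAt E σ H v = -1}.Finite := by
  refine (finite_setOf_hilbertSymbol_eq_neg_one (K := F) hx0 hd0).subset fun v hv => ?_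
  rw [Set.mem_setOf_eq] at hv ⊢
  rw [← hv]
  exact (formSignAt_eq_hilbertSymbol E σ H v hσδ hδ hd hσ hx0 hx).symm

include hσδ hδ hd in
/-- Cofilter form: `formSignAt E σ H v = 1` for all but finitely many finite places `v`. [cite: Rogawski1990, §14.6 p. 242 («it is `+1` for almost all `v`»)] -/
theorem eventually_formSignAt_eq_one [Algebra.IsQuadraticExtension F E] (hσ : σ ≠ 1) {x : F} (hx0 : x ≠ 0) (hx : algebraMap F E x = -H.det) (hd0 : d ≠ 0) :
    ∀ᶠ v in Filter.cofinite, formSignAt E σ H v = 1 := by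
  rw [Filter.eventually_cofinite]
  refine (finite_setOf_formSignAt_eq_neg_one E σ H hσδ hδ hd hσ hx0 hx hd0).subset fun v hv => ?_
  rw [Set.mem_setOf_eq] at hv ⊢
  exact (formSignAt_eq_one_or_eq_neg_one E σ H v).resolve_left hv

/-! ## §4 The CM frame: finite support of the form sign of a non-degenerate hermitian `H` -/

section CM

variable (L : Type) [Field L] [NumberField L] [IsCMField L]

/-- A CM field has a non-zero purely imaginary element: `δ` with `c δ = −δ ≠ 0`, and then `δ² ∈ L⁺ ∖ {0}`. [cite: Omeara1963, §63B] -/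
theorem exists_cm_delta :
    ∃ (δ : L) (d : ↥(maximalRealSubfield L)), IsCMField.complexConj L δ = -δ ∧ δ ≠ 0 ∧
      δ * δ = algebraMap (↥(maximalRealSubfield L)) L d ∧ d ≠ 0 := by
  obtain ⟨e, he⟩ : ∃ e : L, IsCMField.complexConj L e ≠ e := by
    by_contra h
    push Not at h
    exact IsCMField.complexConj_ne_one L (AlgEquiv.ext h)
  set δ : L := e - IsCMField.complexConj L e with hδdef
  have hcδ : IsCMField.complexConj L δ = -δ := by
    rw [hδdef, map_sub, IsCMField.complexConj_apply_apply, neg_sub]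
  have hδ0 : δ ≠ 0 := fun h0 => he (sub_eq_zero.1 (hδdef ▸ h0)).symm
  have hmem : δ * δ ∈ maximalRealSubfield L := by
    rw [← IsCMField.complexConj_eq_self_iff, map_mul, hcδ, neg_mul_neg]
  refine ⟨δ, ⟨δ * δ, hmem⟩, hcδ, hδ0, rfl, ?_⟩
  intro hd
  have : δ * δ = 0 := by
    have := congrArg (fun z : ↥(maximalRealSubfield L) => (z : L)) hd
    simpa using this
  exact hδ0 (mul_self_eq_zero.1 this)

/-- The determinant of a CM-hermitian matrix lies in `L⁺` (it is fixed by complex conjugation). [cite: Jacobowitz1962, §3 Thm. 3.1] -/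
theorem neg_det_mem_maximalRealSubfield_of_isHermitian {n : Type*} [Fintype n] [DecidableEq n] {H : Matrix n n L}
    (hH : (H.map (cmConjRingHom L))ᵀ = H) : -H.det ∈ maximalRealSubfield L := by
  rw [← IsCMField.complexConj_eq_self_iff, map_neg]
  congr 1
  have h := congrArg Matrix.det hH
  rw [Matrix.det_transpose, ← RingHom.mapMatrix_apply, ← RingHom.map_det] at h
  exact h

/-- **FINITE SUPPORT OF THE FORM SIGN IN A CM FRAME**: for `H ∈ M₃(L)` hermitian for the CM conjugation with `det H ≠ 0` there is a finite set `S` of finite places of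
`L⁺` off which `formSignAt L c H v = 1` («`c_v = 1` for almost all `v`»; the frame constant `∏_v formSignAt` is then a finite product).
[cite: Rogawski1990, §14.6 p. 242] [cite: Omeara1963, §71 Thm. 71:18] -/
theorem exists_finset_forall_formSignAt_eq_one (H : Matrix (Fin 3) (Fin 3) L) (hH : (H.map (cmConjRingHom L))ᵀ = H) (hdet : H.det ≠ 0) :
    ∃ S : Finset (HeightOneSpectrum (𝓞 ↥(maximalRealSubfield L))), ∀ v ∉ S, formSignAt L (IsCMField.complexConj L) H v = 1 := by
  haveI : Algebra.IsQuadraticExtension ↥(maximalRealSubfield L) L := IsCMField.isQuadraticExtension L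
  obtain ⟨δ, d, hσδ, hδ, hd, hd0⟩ := exists_cm_delta L
  set x : ↥(maximalRealSubfield L) := ⟨-H.det, neg_det_mem_maximalRealSubfield_of_isHermitian L hH⟩ with hxdef
  have hx : algebraMap (↥(maximalRealSubfield L)) L x = -H.det := rfl
  have hx0 : x ≠ 0 := by
    intro h0
    have : (-H.det : L) = 0 := by
      have := congrArg (fun z : ↥(maximalRealSubfield L) => (z : L)) h0
      simpa [hxdef] using this
    exact hdet (neg_eq_zero.1 this)
  have hfin := finite_setOf_formSignAt_eq_neg_one L (IsCMField.complexConj L) H hσδ hδ hd (IsCMField.complexConj_ne_one L) hx0 hx hd0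
  refine ⟨hfin.toFinset, fun v hv => ?_⟩
  refine (formSignAt_eq_one_or_eq_neg_one L (IsCMField.complexConj L) H v).resolve_right fun h => hv ?_
  exact hfin.mem_toFinset.2 h

/-- Cofilter form in a CM frame. [cite: Rogawski1990, §14.6 p. 242] -/
theorem eventually_formSignAt_eq_one_cm (H : Matrix (Fin 3) (Fin 3) L) (hH : (H.map (cmConjRingHom L))ᵀ = H) (hdet : H.det ≠ 0) :
    ∀ᶠ v in Filter.cofinite, formSignAt L (IsCMField.complexConj L) H v = 1 := by
  obtain ⟨S, hS⟩ := exists_finset_forall_formSignAt_eq_one L H hH hdet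
  rw [Filter.eventually_cofinite]
  exact S.finite_toSet.subset fun v hv => by_contra fun hvS => hv (hS v fun h => hvS (Finset.mem_coe.2 h))

end CM

end Literature.NumberTheory.Automorphic.UnitaryGroup

end
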